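import Summits.CriticalPhenomena.Ising3DConformalLimit.Theorems.HyperoctahedralRPExistsScaleCovariantLimitPairLatticeStepOfDoubling
import Summits.CriticalPhenomena.Ising3DConformalLimit.Theorems.HyperoctahedralRPExistsScaleCovariantLimitPairEquicontOfSeparableHoelder
import HarnessLib

/-!
# Item 6150 alone gives the Hölder-`1/2` move modulus of the pinned PAIR zoom (stub F5 of line `Sketch`,
# crux `ExistsScaleCovariantLimit`, item stmt-CriticalPhenomena-1981; registered stub `stub_pairMoveHoelder_of_doubling`;
# lead c5, 2026-08-16)

Route `MirrorHoelderCompactness`'s item 6151 `SeparableHoelder` (the one-point-move Hölder-`1/2` modulus of the pinned zoom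
at nine-mirror-separable configurations, conditional on item 6150 `TwoPointDoubling`) is proved here AT ORDER TWO, where its
separation clause is automatic: on a compact set `K` of non-coincident pairs the pair distance is `≥ s > 0`, so some
coordinate separates the two points with margin `m = s/2`. The landed lattice step `stub_pairLatticeStep` (F5a, the MHC
lattice Hölder estimate at a coordinate mirror) with the scales `q = ⌊m/(64δ)⌋`, `R = ⌊m/(2δ)⌋ − 5` bounds the squared
difference of the critical pair correlators under a move `xᵢ ↦ y`, `‖y − xᵢ‖ ≤ m/64`, by
`(2g(4q)/(4q+1)·‖[xᵢ/δ] − [y/δ]‖₁)(2g(R))`; all-scale axis doubling at the FIXED ratio `2^J ≥ 32/m` and Messager–Miracle-Solé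
give `g(4q), g(R) ≤ κ^{-J} g(⌊1/δ⌋)`, and `‖[xᵢ/δ] − [y/δ]‖₁/(4q+1) ≤ 96(‖y − xᵢ‖ + δ)/m`; rescaling by `ρ_pin⁴ = g(⌊1/δ⌋)^{-2}`
(`sq_pairZoom_sub_le`) gives `|F₂(x with xᵢ ↦ y) − F₂(x)| ≤ 2κ^{-J}√(96/m)·(‖y − xᵢ‖ + δ)^{1/2}` for `δ < min(m/128, 1/2)`.
Consequence (skeleton v14 of the line): item 5955 ⟺ item 4658 ⟺ item 6150, crux ⟺ 6150 ∧ S2' ∧ S3' ⟺ 6150 ∧ 6153.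

References: M. Aizenman, H. Duminil-Copin, Ann. Math. 194 (2021), arXiv:1912.07973, Prop. 5.9, Remark 5.10, §6.3
[AizenmanDuminilCopinAnnals2021]; A. Messager, S. Miracle-Solé, J. Stat. Phys. 17 (1977) [MessagerMiracleSoleJSP1977];
J. Fröhlich, R. Israel, E. H. Lieb, B. Simon, Comm. Math. Phys. 62 (1978) §2 [FILS1978]. No definitions, no `sorry`.
-/

noncomputable section

open Literature.Probability.LatticeModels Filter Set Function
open scoped Topology
open Summit.CriticalPhenomena.Ising3DConformalLimit.MoebiusLimitExistsOnlyInteraction (rhoPin rhoPin_sq)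
open Summit.CriticalPhenomena.Ising3DConformalLimit.MirrorHoelderCompactnessSeparableHoelder
  (le_inv_pow_mul_of_doubling_of_le criticalTwoPoint_single_anti)

namespace Summit.CriticalPhenomena.Ising3DConformalLimit.Cruxes.ExistsScaleCovariantLimit.TwoHierarchies

/-- Axis doubling of the critical two-point function in the `ℕ → ℝ` form used by
`le_inv_pow_mul_of_doubling_of_le` (cast bookkeeping `((2t : ℕ) : ℤ) = 2·(t : ℤ)`). [folklore] -/
theorem axisDoubling_natForm {κ : ℝ}
    (h : ∀ n : ℕ, 1 ≤ n → κ * criticalTwoPoint 3 (Pi.single 0 (n : ℤ)) ≤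
      criticalTwoPoint 3 (Pi.single 0 (2 * (n : ℤ)))) :
    ∀ t : ℕ, 1 ≤ t → κ * criticalTwoPoint 3 (Pi.single 0 (t : ℤ)) ≤
      criticalTwoPoint 3 (Pi.single 0 ((2 * t : ℕ) : ℤ)) := by
  intro t ht
  have h' := h t ht
  push_cast
  exact h'

/-- If `s ≤ ‖v‖` in `ℝ³` then some coordinate of `v` has absolute value `≥ s/2` (the largest coordinate
square is at least a third of `‖v‖²`, and `1/3 ≥ 1/4`). [folklore] -/
theorem exists_coord_abs_ge_half {v : EuclideanSpace ℝ (Fin 3)} {s : ℝ} (hs0 : 0 ≤ s) (hs : s ≤ ‖v‖) :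
    ∃ τ : Fin 3, s / 2 ≤ |v τ| := by
  obtain ⟨τ, hτ⟩ := exists_sq_norm_le_three_mul_sq v
  refine ⟨τ, ?_⟩
  have h1 : (s / 2) ^ 2 ≤ |v τ| ^ 2 := by
    rw [sq_abs]
    nlinarith [norm_nonneg v]
  by_contra hlt
  push Not at hlt
  nlinarith [abs_nonneg (v τ)]

/-- From a squared bound `D² ≤ C²·t` with `C, t ≥ 0` to `|D| ≤ C·t^{1/2}`. [folklore] -/
theorem abs_le_mul_rpow_half_of_sq_le {D C t : ℝ} (hC : 0 ≤ C) (ht : 0 ≤ t) (h : D ^ 2 ≤ C ^ 2 * t) :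
    |D| ≤ C * t ^ (1 / 2 : ℝ) := by
  have habs := Real.abs_le_sqrt h
  rwa [Real.sqrt_mul' _ ht, Real.sqrt_sq hC, Real.sqrt_eq_rpow] at habs

/-- **F5 (registered stub of line `Sketch`) — item 6150 `TwoPointDoubling` ALONE gives the one-point-move
Hölder-`1/2` modulus of the pinned PAIR zoom** (item 6151 `SeparableHoelder` at order two, its separation clause
discharged: every non-coincident pair is coordinate-separated with margin half the pair separation of `K`). For every
compact set `K` of non-coincident pairs there are `C, δ₀, h₀ > 0` such that for `δ < δ₀`, `x ∈ K`, and a move of one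
point `xᵢ ↦ y` with `‖y − xᵢ‖ ≤ h₀`,
`|F₂^δ(x with xᵢ ↦ y) − F₂^δ(x)| ≤ C (‖y − xᵢ‖ + δ)^{1/2}`, `F₂^δ = rescaledCorrelator (criticalCorr 3) ρ_pin 2 δ`.
Proof: F5a `stub_pairLatticeStep` at the scales of `exists_two_scales`, doubling at the fixed ratio `2^J ≥ 32/m` with MMS
(`le_inv_pow_mul_of_doubling_of_le`), and the rescaling `sq_pairZoom_sub_le`.
[cite: AizenmanDuminilCopinAnnals2021, arXiv:1912.07973 Prop. 5.9 and Remark 5.10] -/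
theorem stub_pairMoveHoelder_of_doubling
    (hD : Summit.CriticalPhenomena.Ising3DConformalLimit.Theses.MirrorHoelderCompactness.TwoPointDoubling) :
    ∀ K : Set (Fin 2 → EuclideanSpace ℝ (Fin 3)), K ⊆ NonCoincident 3 2 → IsCompact K →
      ∃ C δ₀ h₀ : ℝ, 0 < δ₀ ∧ 0 < h₀ ∧ ∀ δ ∈ Set.Ioo 0 δ₀, ∀ x ∈ K, ∀ (i : Fin 2) (y : EuclideanSpace ℝ (Fin 3)),
        ‖y - x i‖ ≤ h₀ →
        |rescaledCorrelator (criticalCorr 3) rhoPin 2 δ (Function.update x i y) -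
          rescaledCorrelator (criticalCorr 3) rhoPin 2 δ x| ≤ C * (‖y - x i‖ + δ) ^ (1 / 2 : ℝ) := by
  intro K hKs hK
  obtain ⟨κ, hκ, hdouble⟩ := hD
  have hdouble' := axisDoubling_natForm hdouble
  have hanti : ∀ a b : ℕ, 1 ≤ a → a ≤ b →
      criticalTwoPoint 3 (Pi.single 0 (b : ℤ)) ≤ criticalTwoPoint 3 (Pi.single 0 (a : ℤ)) :=
    fun a b _ hab => criticalTwoPoint_single_anti hab
  -- pair separation on `K` and the coordinate margin `m = s/2`
  obtain ⟨s, hs, hsK⟩ := exists_pairSep_two hKs hK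
  set m : ℝ := s / 2 with hm_def
  have hm : 0 < m := by positivity
  have hm0 : m ≠ 0 := hm.ne'
  -- the fixed doubling ratio `2^J ≥ 32/m` and the constant `A = κ^{-J}`
  obtain ⟨J, hJ⟩ := exists_pow_two_ge (32 / m)
  set A : ℝ := κ⁻¹ ^ J with hA_def
  have hA : 0 ≤ A := pow_nonneg (inv_nonneg.2 hκ.le) J
  refine ⟨2 * A * Real.sqrt (96 / m), min (m / 128) (1 / 2), m / 64,
    lt_min (by positivity) (by norm_num), by positivity, ?_⟩
  intro δ hδ x hx i y hy
  have hδ0 : 0 < δ := hδ.1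
  have hδ0' : δ ≠ 0 := hδ0.ne'
  have hδm : δ ≤ m / 128 := hδ.2.le.trans (min_le_left _ _)
  have hδhalf : δ < 1 / 2 := lt_of_lt_of_le hδ.2 (min_le_right _ _)
  have hmδ : 128 ≤ m / δ := by
    rw [le_div_iff₀ hδ0]
    linarith
  -- the other index of the pair
  obtain ⟨j, hij⟩ : ∃ j : Fin 2, i ≠ j := by
    fin_cases i
    · exact ⟨1, by decide⟩
    · exact ⟨0, by decide⟩
  -- coordinate separation with margin `m`
  obtain ⟨τ, hτ⟩ := exists_coord_abs_ge_half hs.le (hsK x hx i j hij)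
  have hsep : m ≤ |x i τ - x j τ| := by
    rw [hm_def, ← PiLp.sub_apply]
    exact hτ
  -- the two integer scales
  obtain ⟨q, R, hq, h32q, h16q, -, hR5, hR6⟩ := exists_two_scales hm hδ0 hδm
  have hR5' : (R : ℝ) + 5 ≤ m / 2 / δ := by rwa [div_right_comm]
  -- the lattice Hölder step (F5a)
  have hlat := stub_pairLatticeStep hδ0 hij hsep hy hq h16q hR5' le_rfl hmδ
  -- the pinning scale `N = ⌊1/δ⌋ ≥ 1`
  set N : ℕ := ⌊1 / δ⌋₊ with hN_def
  have h1δ : (2 : ℝ) < 1 / δ := by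
    rw [lt_div_iff₀ hδ0]
    linarith
  have hN : (⌊1 / δ⌋ : ℤ) = (N : ℤ) := (Int.natCast_floor_eq_floor (by positivity)).symm
  have hNle : (N : ℝ) ≤ 1 / δ := Nat.floor_le (by positivity)
  have hN1 : 1 ≤ N := Nat.le_floor (by push_cast; linarith)
  -- `N ≤ 2^J · 4q`
  have h4q : 1 / δ ≤ (2 : ℝ) ^ J * (4 * (q : ℝ)) := by
    have h := mul_le_mul hJ h32q (by positivity) (by positivity)
    have e : 32 / m * (m / δ / 32) = 1 / δ := by
      field_simp
    rw [e] at h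
    exact h
  have hN4q : N ≤ 2 ^ J * (4 * q) := by
    have h : (N : ℝ) ≤ (2 : ℝ) ^ J * (4 * (q : ℝ)) := hNle.trans h4q
    exact_mod_cast h
  -- `4q ≤ R`
  have hR4q : 4 * q ≤ R := by
    have h : ((4 * q : ℕ) : ℝ) ≤ (R : ℝ) := by
      push_cast
      linarith
    exact_mod_cast h
  -- the two ratio bounds from doubling at the fixed ratio and MMS
  have ha : criticalTwoPoint 3 (Pi.single 0 ((4 * q : ℕ) : ℤ)) ≤
      A * criticalTwoPoint 3 (Pi.single 0 (N : ℤ)) :=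
    le_inv_pow_mul_of_doubling_of_le (g := fun t : ℕ => criticalTwoPoint 3 (Pi.single 0 (t : ℤ)))
      hκ hdouble' hanti J (by omega) hN1 hN4q
  have hb : criticalTwoPoint 3 (Pi.single 0 (R : ℤ)) ≤ A * criticalTwoPoint 3 (Pi.single 0 (N : ℤ)) :=
    (criticalTwoPoint_single_anti hR4q).trans ha
  -- the `ℓ¹` length of the move relative to the gradient scale
  have hc : (Site.l1Dist (latticeApprox δ (x i)) (latticeApprox δ y) : ℝ) / (4 * (q : ℝ) + 1) ≤
      96 * (‖y - x i‖ + δ) / m := by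
    have hL := l1Dist_latticeApprox_le_div hδ0 (x i) y
    rw [norm_sub_rev] at hL
    rw [div_le_iff₀ (by positivity : (0 : ℝ) < 4 * (q : ℝ) + 1)]
    have h1 : 3 * (‖y - x i‖ + δ) / δ ≤ 96 * (‖y - x i‖ + δ) / m * (4 * (q : ℝ)) := by
      have e : 3 * (‖y - x i‖ + δ) / δ = 96 * (‖y - x i‖ + δ) / m * (m / δ / 32) := by
        field_simp
        ring
      rw [e]
      exact mul_le_mul_of_nonneg_left h32q (by positivity)
    have h2 : 96 * (‖y - x i‖ + δ) / m * (4 * (q : ℝ)) ≤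
        96 * (‖y - x i‖ + δ) / m * (4 * (q : ℝ) + 1) :=
      mul_le_mul_of_nonneg_left (by linarith) (by positivity)
    linarith
  -- rescaling by `ρ_pin⁴`
  have hsq := sq_pairZoom_sub_le (A := A) (c := 96 * (‖y - x i‖ + δ) / m) hN hlat ha hb hc
  rw [pairZoom_eq, pairZoom_eq]
  have ht : 0 ≤ ‖y - x i‖ + δ := by positivity
  have hC : 0 ≤ 2 * A * Real.sqrt (96 / m) := by positivity
  refine abs_le_mul_rpow_half_of_sq_le hC ht (hsq.trans_eq ?_)
  rw [mul_pow, mul_pow, Real.sq_sqrt (by positivity)]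
  field_simp
  ring

end Summit.CriticalPhenomena.Ising3DConformalLimit.Cruxes.ExistsScaleCovariantLimit.TwoHierarchies

end
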